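import Summits.QuantumFields.YangMills.Theorems.TwistedTraceScaling.Negative.ShellWitnessBelowThreshold
import HarnessLib

/-!
# Negative lemma R70 (crux `TwistedTraceScaling`, stmt-QuantumFields-20203): the POINTWISE-CELL route to the C4-SHELL gain needs a LINEAR one-site gain on the
# inner annulus `β^{−s}/2 ≤ t ≤ β^{−7/45}` of the record shell — the tree's `t√t/40` gain (✓`oneSite_shell_gain`) is transported by NO frozen-Gaussian cell there:
# at the record action layer `q = 17/20` for every core exponent `s > 1/6`, and at every door-admissible layer `q < 8/9` once `s ≥ 14/81`

Standing disprover `ym-cdisprove-20203-1` (gen 57), vetting the state of lane A after the (B-ST) pen closed (✓`…C4CoreRecord`, lead g23: C4-CORE(s)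
`innerNoIntruderOneOrbitAt_record (2 ≤ L) (1/6 < s < 1/5)` UNCONDITIONAL; COARSE-UPPER(L) ⟸ ONE statement in four currencies, among them the small-action SHELL GAIN
`InnerShellGainSmallAt L (powScale s) (powScale (1/40)) (powScale (17/20))` via ✓`coarseUpper_of_shellSmall`, i.e. the door ✓`coarseNoIntruderAt_of_core_shellSmall_pow`
at its record tuple `(p,q,r,m) = (1/40, 17/20, 41/100, 11/200)`, whose action-layer exponent is capped by the hypothesis `hq : q < 8/9`).
The only typed one-site input for that shell is ✓`…OneSiteShellGain.oneSite_shell_gain`: gain factor `(1 − t√t/40)` for `f = 0` on `{‖zmCoord 1 U‖ < t}`, `B^{−1/5} ≤ t ≤ 1/5000`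
(supersolution over a kinetic length `≍ √t`), i.e. the gain SCALE `β^{−3s'/2}` at shell position `t = β^{−s'}` (R23 `gain_at_core_eq`); COARSE-DESIGN §22.6 proposes to transport
it to the `L³` lattice by POINTWISE frozen-Gaussian cells.  R24 §5 typed the two costs of such a cell of power-law radius `β^{−ρ}` on the stiff layer `|w|² ≲ β^{−q}` (= the
small-action layer `S < 2β^{−q}` up to the lattice Poincaré constant) — IMS `β^{−(1−2ρ)}` and first-order slow–stiff coupling `β^{−(ρ+q−1)}` (`R24.cell_costs_eq`) — against the
gain exponent `3s/2` only.  This file runs the same bookkeeping for a GENERIC gain exponent `g` (gain scale `β^{−g}` available at the cell):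
* §1 ★ `cell_exponents_gain_iff`: `(∃ ρ, g < 1 − 2ρ ∧ g < ρ + q − 1) ↔ g < (2q − 1)/3` (eventual-scale form `cell_costs_eventually_gain_iff`).  Specialisations: the `t^{3/2}`
  gain `g = 3s'/2` ↔ `s' < (4q − 2)/9` (= the landed R24 `cell_pointwise_exponents_iff`, reused), a LINEAR gain `g = s'` ↔ `s' < (2q − 1)/3`; and `β^{−3s'/2} ≤ β^{−s'}` — the black
  box's gain is the weaker one at every position (`threeHalves_gain_le_linear`).
* §2 ★★ RECORD LAYER `q = 17/20`: LINEAR window `s' < 7/30 ⊃ (1/40, 1/5]` — EVERY position `s' ≤ s` of the record shell, for every core exponent `s < 1/5`, admits a cell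
  radius, `ρ ∈ (s' + 3/20, (1 − s')/2)`, e.g. `ρ = 3/8` at `s' = 1/5` (`linear_cells_cover_record_shell`, `linear_record_rho_window_iff`); `t^{3/2}` window `s' < 7/45`:
  the OUTER part `t > β^{−7/45}` of the shell is covered (`threeHalves_cells_cover_outer`), the INNER ANNULUS of positions `7/45 ≤ s' ≤ s` by NO cell radius
  (`threeHalves_cells_fail_inner_annulus`, eventual form `threeHalves_inner_annulus_eventually_fails`), and that annulus is non-empty for every admissible core:
  `s − 7/45 > 1/90` (`inner_annulus_width`).  The one-site theorem APPLIES on the annulus (`t ≥ B^{−1/5}` ⇐ `s' < 1/5` eventually, R24 `threshold_le_witness_radius_eventually`):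
  it is its GAIN RATE, not its window, that is too weak for pointwise transport.
* §3 ★★ THE DOOR'S CAP `q < 8/9`: `(∃ q < 8/9, t^{3/2}-cells at position s') ↔ s' < 14/81`, linear `↔ s' < 7/27` (`threeHalves_cap_iff`, `linear_cap_iff`); chain
  `7/45 < 1/6 < 14/81 < 1/5 < 7/30 < 7/27`, `14/81 − 1/6 = 1/162` (`exponent_chain`): NO admissible layer rescues the `t^{3/2}` cells at positions `s' ≥ 14/81`
  (`no_layer_rescues_threeHalves`), whereas raising `q` into `(7/8, 8/9)` buys the core only the razor `(1/6, (4q−2)/9) ⊂ (1/6, 14/81)` — e.g. the door-admissible tuple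
  `(p,q,r,m) = (1/40, 22/25, 41/100, 11/200)` (`razor_tuple_admissible`: the ten arithmetic hypotheses of the door) gives `(1/6, 38/225)`, width `1/450` (`razor_window`) —
  while linear cells work on every layer `q ≥ 4/5` for every `s < 1/5` (`every_layer_admits_linear`).
* §4 `hybrid_ledger`: the facts at once for `s ∈ (1/6, 1/5)`.
DESIGN CONSEQUENCE (information for lead g23 / the C4-SHELL LOCATE memo, not a defect of any landed text): on the pointwise-cell route of §22.6 the one-site black box must be
UPGRADED on a window `[B^{−a}, t₀]`, `a > s`, to a LINEAR gain `qform su2Rep B f f ≤ linkCE B·(1 − c·t)·l2 f f` — the harmonic transverse (W-mode) zero-point shift, valid where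
`t ≫ B^{−1/3}` (Lüscher's linear term of the effective toron potential; van Baal–Koller §4; on the lattice the kink slope `gain1Slope L κ > 0`, R17 `…Negative.ZpeKink`; R23
`linear_gain_dominates_iff`: a linear gain beats `A·λ_b` iff `s < 1/3`).  With it the exponent bookkeeping of pointwise cells closes on the whole record shell; without it the inner
annulus needs the averaged (Feshbach ∕ BO-stiff) machinery of the pen, or one of the valley currencies (`ValleyBOAt` ∕ `ValleyBOWeakAt`, whose weight `e^{−zpeSum}` IS the linear
gain).  Exponents only: constants, `L`-factors and the Boltzmann bookkeeping of the layer `q` are not modelled (as in R24 §5).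

HONEST FRAMING: negative/design bookkeeping about the SHELL brick of stub S-BASE (C4) of a child of the CONDITIONAL reduction route R2b1 (rank 202); nothing here is
`¬TwistedTraceScaling`, nothing is a gap, nothing is Clay.  Not Mathlib material: project-specific bookkeeping.
-/

set_option autoImplicit false

noncomputable section

open Real
open Summit.QuantumFields.YangMills.Theorems.FemtoTransferGap

namespace Summit.QuantumFields.YangMills.Theorems.TwistedTraceScaling.Negative.R70

/-! ## §1 A frozen-Gaussian cell against a generic gain exponent -/

/-- ★ **Cell window for a generic gain**: a cell of radius `β^{−ρ}` on the stiff layer `|w|² ≲ β^{−q}` has both costs — IMS `β^{−(1−2ρ)}`, first-order coupling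
`β^{−(ρ+q−1)}` — below a gain of scale `β^{−g}` for SOME `ρ` iff `g < (2q − 1)/3`. [folklore] -/
theorem cell_exponents_gain_iff {g q : ℝ} :
    (∃ ρ : ℝ, g < 1 - 2 * ρ ∧ g < ρ + q - 1) ↔ g < (2 * q - 1) / 3 := by
  constructor
  · rintro ⟨ρ, h1, h2⟩
    linarith
  · intro h
    exact ⟨((1 - g) / 2 + (g + 1 - q)) / 2, by linarith, by linarith⟩

/-- The admissible radii form the interval `ρ ∈ (g + 1 − q, (1 − g)/2)`. [folklore] -/
theorem cell_rho_window_iff {g q ρ : ℝ} : (g < 1 - 2 * ρ ∧ g < ρ + q - 1) ↔ g + 1 - q < ρ ∧ ρ < (1 - g) / 2 := by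
  constructor <;> rintro ⟨h1, h2⟩ <;> exact ⟨by linarith, by linarith⟩

/-- The same as eventual statements about the scales (`R24.forall_mul_powScale_le_eventually_iff`): each cost beats EVERY multiple of the gain `β^{−g}` iff its exponent
is the larger one. [folklore] -/
theorem cell_costs_eventually_gain_iff {g q ρ : ℝ} :
    ((∀ C : ℝ, ∃ β0 : ℝ, ∀ β : ℝ, β0 ≤ β → C * powScale (1 - 2 * ρ) β ≤ powScale g β) ↔ g < 1 - 2 * ρ) ∧
      ((∀ C : ℝ, ∃ β0 : ℝ, ∀ β : ℝ, β0 ≤ β → C * powScale (ρ + q - 1) β ≤ powScale g β) ↔ g < ρ + q - 1) :=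
  ⟨R24.forall_mul_powScale_le_eventually_iff, R24.forall_mul_powScale_le_eventually_iff⟩

-- Specialisation `g = 3s/2` (the `t√t` gain of ✓`oneSite_shell_gain` at position `t = β^{−s}`): window `s < (4q − 2)/9` — this is the landed
-- `R24.cell_pointwise_exponents_iff`, used below as is.

/-- Specialisation `g = s` (a LINEAR gain `c·t` at position `t = β^{−s}`): window `s < (2q − 1)/3`. [folklore] -/
theorem cell_exponents_linear_iff {s q : ℝ} :
    (∃ ρ : ℝ, s < 1 - 2 * ρ ∧ s < ρ + q - 1) ↔ s < (2 * q - 1) / 3 :=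
  cell_exponents_gain_iff

/-- At every position of non-negative exponent the `t^{3/2}` gain scale is the SMALLER one: `β^{−3s/2} ≤ β^{−s}` (`s ≥ 0`; all `β`). [folklore] -/
theorem threeHalves_gain_le_linear {s : ℝ} (hs : 0 ≤ s) (β : ℝ) : powScale (3 * s / 2) β ≤ powScale s β := by
  unfold powScale
  exact Real.rpow_le_rpow_of_exponent_le (le_max_right β 1) (by linarith)

/-! ## §2 The record action layer `q = 17/20` -/

/-- The two record windows: linear `(2·17/20 − 1)/3 = 7/30 > 1/5`, three-halves `(4·17/20 − 2)/9 = 7/45 < 1/6`. [folklore] -/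
theorem record_windows :
    (2 * (17 / 20 : ℝ) - 1) / 3 = 7 / 30 ∧ (4 * (17 / 20 : ℝ) - 2) / 9 = 7 / 45 ∧ (7 / 45 : ℝ) < 1 / 6 ∧ (1 / 5 : ℝ) < 7 / 30 := by
  norm_num

/-- ★★ **Linear cells cover the whole record shell**: for every core exponent `s < 1/5` and every position `s' ≤ s` (the shell is `β^{−s}/2 < orbitDist < β^{−1/40}`)
some cell radius `β^{−ρ}` puts both costs below a LINEAR gain on the record layer `q = 17/20`. [folklore] -/
theorem linear_cells_cover_record_shell {s s' : ℝ} (hs : s < 1 / 5) (hs' : s' ≤ s) :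
    ∃ ρ : ℝ, s' < 1 - 2 * ρ ∧ s' < ρ + 17 / 20 - 1 :=
  cell_exponents_linear_iff.2 (by linarith)

/-- The admissible radii at the record layer for a linear gain: `ρ ∈ (s + 3/20, (1 − s)/2)`. [folklore] -/
theorem linear_record_rho_window_iff {s ρ : ℝ} :
    (s < 1 - 2 * ρ ∧ s < ρ + 17 / 20 - 1) ↔ s + 3 / 20 < ρ ∧ ρ < (1 - s) / 2 := by
  constructor <;> rintro ⟨h1, h2⟩ <;> exact ⟨by linarith, by linarith⟩

/-- Instance at the record core position `s' = 1/5` with `ρ = 3/8` (window `(7/20, 2/5)`). [folklore] -/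
theorem linear_record_core_fifth : (1 / 5 : ℝ) < 1 - 2 * (3 / 8) ∧ (1 / 5 : ℝ) < 3 / 8 + 17 / 20 - 1 := by norm_num

/-- `t^{3/2}` cells DO cover the OUTER part of the record shell: positions `s' < 7/45` (`t > β^{−7/45}`). [folklore] -/
theorem threeHalves_cells_cover_outer {s' : ℝ} (h : s' < 7 / 45) :
    ∃ ρ : ℝ, 3 * s' / 2 < 1 - 2 * ρ ∧ 3 * s' / 2 < ρ + 17 / 20 - 1 :=
  R24.cell_pointwise_exponents_iff.2 (by linarith)

/-- ★★ **No cell radius transports the `t^{3/2}` gain on the INNER ANNULUS** of the record shell: positions `7/45 ≤ s'`. [folklore] -/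
theorem threeHalves_cells_fail_inner_annulus {s' : ℝ} (h : 7 / 45 ≤ s') :
    ¬ ∃ ρ : ℝ, 3 * s' / 2 < 1 - 2 * ρ ∧ 3 * s' / 2 < ρ + 17 / 20 - 1 := by
  rw [R24.cell_pointwise_exponents_iff]
  intro h'
  linarith

/-- The same at the level of scales: on the inner annulus, for EVERY radius exponent `ρ`, one of the two costs fails to be eventually below every multiple of the gain
`β^{−3s'/2}`. [folklore] -/
theorem threeHalves_inner_annulus_eventually_fails {s' : ℝ} (h : 7 / 45 ≤ s') (ρ : ℝ) :
    ¬ ((∀ C : ℝ, ∃ β0 : ℝ, ∀ β : ℝ, β0 ≤ β → C * powScale (1 - 2 * ρ) β ≤ powScale (3 * s' / 2) β) ∧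
        (∀ C : ℝ, ∃ β0 : ℝ, ∀ β : ℝ, β0 ≤ β → C * powScale (ρ + 17 / 20 - 1) β ≤ powScale (3 * s' / 2) β)) := by
  rintro ⟨hA, hB⟩
  have h1 := (cell_costs_eventually_gain_iff (g := 3 * s' / 2) (q := 17 / 20) (ρ := ρ)).1.1 hA
  have h2 := (cell_costs_eventually_gain_iff (g := 3 * s' / 2) (q := 17 / 20) (ρ := ρ)).2.1 hB
  linarith

/-- Conversely, with a LINEAR gain both costs are eventually below every multiple of the gain for each radius in the window `(s' + 3/20, (1 − s')/2)`. [folklore] -/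
theorem linear_record_eventually {s' ρ : ℝ} (h1 : s' + 3 / 20 < ρ) (h2 : ρ < (1 - s') / 2) :
    (∀ C : ℝ, ∃ β0 : ℝ, ∀ β : ℝ, β0 ≤ β → C * powScale (1 - 2 * ρ) β ≤ powScale s' β) ∧
      (∀ C : ℝ, ∃ β0 : ℝ, ∀ β : ℝ, β0 ≤ β → C * powScale (ρ + 17 / 20 - 1) β ≤ powScale s' β) :=
  ⟨(cell_costs_eventually_gain_iff (g := s') (q := 17 / 20) (ρ := ρ)).1.2 (by linarith),
    (cell_costs_eventually_gain_iff (g := s') (q := 17 / 20) (ρ := ρ)).2.2 (by linarith)⟩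

/-- ★ The inner annulus is NON-EMPTY for every admissible core exponent: `7/45 + 1/90 = 1/6`, so `1/90 < s − 7/45 < 2/45` for `s ∈ (1/6, 1/5)`. [folklore] -/
theorem inner_annulus_width {s : ℝ} (hs6 : 1 / 6 < s) (hs5 : s < 1 / 5) :
    (7 / 45 : ℝ) + 1 / 90 = 1 / 6 ∧ 1 / 90 < s - 7 / 45 ∧ s - 7 / 45 < 2 / 45 :=
  ⟨by norm_num, by linarith, by linarith⟩

/-! ## §3 The door's cap `q < 8/9` -/

/-- ★★ **Raising the action layer cannot rescue the `t^{3/2}` cells beyond `14/81`**: `(∃ q < 8/9, s < (4q − 2)/9) ↔ s < 14/81`. [folklore] -/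
theorem threeHalves_cap_iff {s : ℝ} : (∃ q : ℝ, q < 8 / 9 ∧ s < (4 * q - 2) / 9) ↔ s < 14 / 81 := by
  constructor
  · rintro ⟨q, hq, h⟩
    linarith
  · intro h
    exact ⟨((9 * s + 2) / 4 + 8 / 9) / 2, by linarith, by linarith⟩

/-- The linear analogue: `(∃ q < 8/9, s < (2q − 1)/3) ↔ s < 7/27`. [folklore] -/
theorem linear_cap_iff {s : ℝ} : (∃ q : ℝ, q < 8 / 9 ∧ s < (2 * q - 1) / 3) ↔ s < 7 / 27 := by
  constructor
  · rintro ⟨q, hq, h⟩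
    linarith
  · intro h
    exact ⟨((3 * s + 1) / 2 + 8 / 9) / 2, by linarith, by linarith⟩

/-- The exponent chain `7/45 < 1/6 < 14/81 < 1/5 < 7/30 < 7/27` and the razor width `14/81 − 1/6 = 1/162`. [folklore] -/
theorem exponent_chain :
    (7 / 45 : ℝ) < 1 / 6 ∧ (1 / 6 : ℝ) < 14 / 81 ∧ (14 / 81 : ℝ) < 1 / 5 ∧ (1 / 5 : ℝ) < 7 / 30 ∧ (7 / 30 : ℝ) < 7 / 27 ∧
      (14 / 81 : ℝ) - 1 / 6 = 1 / 162 := by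
  norm_num

/-- ★★ **No door-admissible layer rescues the `t^{3/2}` cells at core positions `s ≥ 14/81`** (in particular on `[14/81, 1/5)`, more than two thirds of the admissible
core window `(1/6, 1/5)`). [folklore] -/
theorem no_layer_rescues_threeHalves {s : ℝ} (hs : 14 / 81 ≤ s) :
    ¬ ∃ q : ℝ, q < 8 / 9 ∧ ∃ ρ : ℝ, 3 * s / 2 < 1 - 2 * ρ ∧ 3 * s / 2 < ρ + q - 1 := by
  rintro ⟨q, hq, hρ⟩
  have h := R24.cell_pointwise_exponents_iff.1 hρ
  linarith

/-- The general form: some admissible layer carries `t^{3/2}` cells at position `s` iff `s < 14/81`. [folklore] -/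
theorem layer_rescues_threeHalves_iff {s : ℝ} :
    (∃ q : ℝ, q < 8 / 9 ∧ ∃ ρ : ℝ, 3 * s / 2 < 1 - 2 * ρ ∧ 3 * s / 2 < ρ + q - 1) ↔ s < 14 / 81 := by
  rw [← threeHalves_cap_iff]
  exact exists_congr fun q => and_congr_right fun _ => R24.cell_pointwise_exponents_iff

/-- Linear cells work on EVERY layer `q ≥ 4/5` for every core exponent `s < 1/5` — no razor. [folklore] -/
theorem every_layer_admits_linear {s q : ℝ} (hs5 : s < 1 / 5) (hq : 4 / 5 ≤ q) :
    ∃ ρ : ℝ, s < 1 - 2 * ρ ∧ s < ρ + q - 1 :=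
  cell_exponents_linear_iff.2 (by linarith)

/-- The razor, concretely: the tuple `(p,q,r,m) = (1/40, 22/25, 41/100, 11/200)` satisfies the ten arithmetic hypotheses `hp0, hp, hpq, hq, hr, hr1, hm, hrq, hpm, hC` of
✓`coarseNoIntruderAt_of_core_shellSmall_pow` (so the door accepts the thinner action layer `S < 2β^{−22/25}`). [folklore] -/
theorem razor_tuple_admissible :
    (0 : ℝ) < 1 / 40 ∧ (1 / 40 : ℝ) < 1 / 10 ∧ 4 * (1 / 40 : ℝ) < 22 / 25 ∧ (22 / 25 : ℝ) < 8 / 9 ∧ (0 : ℝ) < 41 / 100 ∧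
      2 * (41 / 100 : ℝ) < 1 ∧ (0 : ℝ) < 11 / 200 ∧ 2 * (41 / 100 : ℝ) < 22 / 25 - 11 / 200 / 2 ∧ (1 / 40 : ℝ) < 11 / 200 / 2 ∧
      1 + 3 * (11 / 200 : ℝ) - 3 * (41 / 100) < -(1 / 40) := by
  norm_num

/-- … and buys the `t^{3/2}` cells the core window `(1/6, 38/225)`, of width `1/450` (and `38/225 < 14/81`). [folklore] -/
theorem razor_window :
    (4 * (22 / 25 : ℝ) - 2) / 9 = 38 / 225 ∧ (1 / 6 : ℝ) < 38 / 225 ∧ (38 / 225 : ℝ) - 1 / 6 = 1 / 450 ∧ (38 / 225 : ℝ) < 14 / 81 := by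
  norm_num

/-! ## §4 The ledger for an admissible core exponent -/

/-- ★★ **Hybrid ledger** for `s ∈ (1/6, 1/5)` at the record layer `q = 17/20`: (i) linear cells at every position `s' ≤ s`; (ii) `t^{3/2}` cells exactly at the positions
`s' < 7/45`; (iii) no admissible layer `q < 8/9` carries `t^{3/2}` cells at the core position unless `s < 14/81`; (iv) the uncovered annulus has exponent width `> 1/90`.
[folklore] -/
theorem hybrid_ledger {s : ℝ} (hs6 : 1 / 6 < s) (hs5 : s < 1 / 5) :
    (∀ s' : ℝ, s' ≤ s → ∃ ρ : ℝ, s' < 1 - 2 * ρ ∧ s' < ρ + 17 / 20 - 1) ∧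
      (∀ s' : ℝ, (∃ ρ : ℝ, 3 * s' / 2 < 1 - 2 * ρ ∧ 3 * s' / 2 < ρ + 17 / 20 - 1) ↔ s' < 7 / 45) ∧
      ((∃ q : ℝ, q < 8 / 9 ∧ ∃ ρ : ℝ, 3 * s / 2 < 1 - 2 * ρ ∧ 3 * s / 2 < ρ + q - 1) ↔ s < 14 / 81) ∧
      1 / 90 < s - 7 / 45 := by
  refine ⟨fun s' hs' => linear_cells_cover_record_shell hs5 hs', fun s' => ?_, layer_rescues_threeHalves_iff, by linarith⟩
  rw [R24.cell_pointwise_exponents_iff]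
  constructor <;> intro h <;> linarith

end Summit.QuantumFields.YangMills.Theorems.TwistedTraceScaling.Negative.R70

end
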